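import Summits.Ventures.CertifiedArithmetic.Expansions.CompressTopSharpTools
import Summits.Ventures.CertifiedArithmetic.Expansions.CompressSharpStair

/-!
# The COMPRESS top error at a power of two is half as large (new work)

New work of the certified-arithmetic venture (ENGINES group: shared numerical engines serving
client cells; rigour lives in the verifiers; every published number belongs to a client cell's
ledger, not to the engines group), continuing `Expansions/CompressTopError.lean`.

THE QUESTION.  `compress_top_error` bounds the error of the largest component `L` of
`compress fl e` (ANY round-to-nearest, `p ≥ 2`, `e` a nonoverlapping expansion of floats) by
`|Σe − L| ≤ ulp(L)/2 · (1 + ε + ⋯ + ε^(k−1))`, `ε = 2^-p`, `k` = number of lower components, and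
this is attained.  Measured in ulps of the EXACT SUM `Σe` instead of ulps of `L` the two agree —
except when `|L| = 2^a` is a power of two and `Σe` lies just inside it (`L · (Σe − L) < 0`), where
`ulp(Σe) = ulp(L)/2`.  Is the bound then also twice as good?

THE THEOREM (`compress_top_error_pow2`).  Yes: if `compress fl e` read from the top is `L, t…`
with `|L| = 2^a` and `L · Σt < 0`, then `|Σt| ≤ ulp(L)/4 · (1 + ε + ⋯ + ε^(k−1))`.
Consequently the top error is at most `ulp(Σe)/2 · (1 + ε + ⋯)` in all cases, and COMPRESS never
overshoots a power of two by rounding: `|Σe| < 2^b − 2^(b−1)/(2^p − 1)` forces `|L| < 2^b`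
(`Expansions/CompressTopNoOvershoot.lean`, which also records why the margin is sharp).  That
corollary is the tool for the last case of "COMPRESS twice keeps the top component"
(`Expansions/CompressTopStableTools.lean` and sequels): after a reflected emission the
re-compressed lower part must be shown not to climb back onto the power of two it came from.

THE PROOF re-runs the second-traversal induction of `compress_top_error` (its invariant
`|Σ rs| ≤ ulp(Q)/2 · G`, the sharp stair of `compressDown_sharp_stair`, the carry bound
`compressUp_carry_lt_ulp`) with ONE MORE INVARIANT: whenever the carry `Q` is a power of two and
the emitted components point from it towards zero, `|Σ rs| ≤ ulp(Q)/4 · G`.  The two step lemmas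
are in `Expansions/CompressTopSharpTools.lean`:
* emitting step onto a power of two `Qn = fl(g + Q)`, `|Qn| = 2^a`, from inside: the roundoff is
  `≤ ulp(Qn)/4` (a quarter, not a half: `ulp(g + Q) = ulp(Qn)/2`), and the previous carry even
  satisfies `|Q| < ulp(Qn)/2` (`carry_lt_half_ulp_of_pow2`), so the older components weigh at
  most `ε · ulp(Qn)/4 · G` — total `ulp(Qn)/4 · (1 + ε G)`;
* exact step onto a power of two `g + Q`: `ulp Q ≤ ulp(g + Q)/2` (`sum_le_quarter_ulp_after_absorb`;
  the `p = 2` corner `|g| = 2 ulp g`, `Q = ∓ulp g` is excluded by the sharp stair), so the old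
  half-ulp bound in ulps of `Q` is a quarter-ulp bound in ulps of `g + Q`.

NUMERICAL EVIDENCE (seat folder `desk/topP.py`, exact rational model of COMPRESS with EVERY tie
broken both ways, i.e. all round-to-nearest maps at once): `p = 3`, exponent range 10, `n ≤ 4`:
138 068 runs; `p = 2`, range 9, `n ≤ 5`: 95 784 runs — `|Σe − L| ≤ ulp(Σe)/2 · G` with 0
violations and the ratio `G` attained.

HONEST FRAMING: new work of this programme checked in Lean — a modest sharpening of a bound on a
textbook procedure, not a published result and no open problem; [Shewchuk1997, §2.7 Thm 23
p. 331–333] and [BoldoEtAl2023, §2] supply only the objects.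
-/

namespace Summit.Ventures.CertifiedArithmetic.Expansions

open Literature.ComputerArithmetic.JeannerodRump2018
open Literature.ComputerArithmetic.BoldoJeannerodMelquiondMuller2023 hiding twoSum twoSum_fst
open Literature.ComputerArithmetic.JoldesMullerPopescu2017 (ulp_le_of_abs_lt_two_zpow)
open Literature.ComputerArithmetic.GraillatMuller2025 (ulp_two_zpow)
open Literature.ComputerArithmetic.Shewchuk1997

variable {p : ℕ} {emin : ℤ} {fl : ℚ → ℚ}

/-! ### The second traversal with the doubly sharp invariant -/

/-- THE SECOND TRAVERSAL, threading (besides the sharp stair of the remaining components `gs`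
and the invariant `|Σ rs| ≤ ulp(Q)/2 · G` of `compress_top_error`) the POWER-OF-TWO SHARPENING:
whenever the carry `Q` is a power of two and the emitted components point from it towards zero,
`|Σ rs| ≤ ulp(Q)/4 · G` — i.e. the error is measured in ulps of the exact partial sum `Q + Σ rs`,
whose ulp is then `ulp(Q)/2`.  Conclusion: the same for the final list. -/
private theorem compressUp_top_sharp (hp : 2 ≤ p) (hfl : IsRoundNearest p emin fl) :
    ∀ (gs : List ℚ) (Q : ℚ) (rs : List ℚ), UpInv p emin 1 rs Q →
      |rs.sum| ≤ ulp p emin Q / 2 * (Finset.range rs.length).sum (fun i => ((2 : ℚ) ^ p)⁻¹ ^ i) →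
      (∀ a : ℤ, |Q| = 2 ^ a → Q * rs.sum < 0 →
        |rs.sum| ≤ ulp p emin Q / 4 *
          (Finset.range rs.length).sum (fun i => ((2 : ℚ) ^ p)⁻¹ ^ i)) →
      (∀ g ∈ gs, IsFloat p emin g) → (∀ g ∈ gs, (2 : ℚ) ^ (emin + p) ≤ |g|) →
      UStair p emin (Q + rs.sum) gs →
      (∀ (pre post : List ℚ) (g : ℚ), gs = pre ++ g :: post →
        (∃ j : ℤ, emin + p ≤ j ∧ |g| = 2 ^ j) → g * (Q + rs.sum + pre.sum) < 0 →
        |Q + rs.sum + pre.sum| < ulp p emin g / 2) →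
      gs.IsChain (fun a b => |a| ≤ ulp p emin b) →
      (∀ g ∈ gs.head?, |Q| ≤ ulp p emin g) →
      ∀ L t, (rs.reverse ++ compressUp fl Q gs).reverse = L :: t →
        ∀ a : ℤ, |L| = 2 ^ a → L * t.sum < 0 →
          |t.sum| ≤ ulp p emin L / 4 *
            (Finset.range t.length).sum (fun i => ((2 : ℚ) ^ p)⁻¹ ^ i) := by
  have hp1 : 1 ≤ p := le_trans (by norm_num) hp
  have hflc : RoundoffBelow 1 fl := roundoffBelow_one hp1 hfl
  have h2 : (2 : ℚ) ≠ 0 := by norm_num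
  intro gs
  induction gs with
  | nil =>
    intro Q rs _ _ hIs _ _ _ _ _ _ L t hL
    rw [compressUp_nil, List.reverse_append, List.reverse_singleton, List.reverse_reverse,
      List.singleton_append] at hL
    obtain ⟨hQL, hrs⟩ := List.cons_eq_cons.mp hL
    subst hQL; subst hrs; exact hIs
  | cons g rest ih =>
    intro Q rs inv hI hIs hF hbig hst hsh hch hQg L t hL
    have hg : IsFloat p emin g := hF g (by simp)
    have hgbig : (2 : ℚ) ^ (emin + p) ≤ |g| := hbig g (by simp)
    have hQg' : |Q| ≤ ulp p emin g := hQg g (by simp)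
    have hF' : ∀ x ∈ rest, IsFloat p emin x := fun x hx => hF x (List.mem_cons_of_mem _ hx)
    have hbig' : ∀ x ∈ rest, (2 : ℚ) ^ (emin + p) ≤ |x| :=
      fun x hx => hbig x (List.mem_cons_of_mem _ hx)
    obtain ⟨hstg, hst'⟩ := uStair_cons.mp hst
    obtain ⟨hgU, hch'⟩ := List.isChain_cons.mp hch
    have hg0 : g ≠ 0 := by
      intro h; rw [h, abs_zero] at hgbig
      exact absurd hgbig (not_le.mpr (zpow_pos (by norm_num) _))
    have hulpg : ulp p emin g ≤ |g| := ulp_le_abs_of_isFloat hg hg0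
    have hQleg : |Q| ≤ |g| := hQg'.trans hulpg
    obtain ⟨h1, -, h2', h4⟩ := fastTwoSum_exact hp1 hfl hg inv.hQ hQleg
    -- the sharp stair under `g` itself
    have hsh_g : (∃ j : ℤ, emin + p ≤ j ∧ |g| = 2 ^ j) → g * (Q + rs.sum) < 0 →
        |Q + rs.sum| < ulp p emin g / 2 := by
      intro hpow hsgn
      have := hsh [] rest g rfl hpow (by simpa using hsgn)
      simpa using this
    -- … and under the later components, re-addressed for the next state `(Qn, rs')`
    have hthread : ∀ (Qn : ℚ) (rs' : List ℚ), Qn + rs'.sum = Q + rs.sum + g →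
        ∀ (pre post : List ℚ) (g' : ℚ), rest = pre ++ g' :: post →
          (∃ j : ℤ, emin + p ≤ j ∧ |g'| = 2 ^ j) → g' * (Qn + rs'.sum + pre.sum) < 0 →
          |Qn + rs'.sum + pre.sum| < ulp p emin g' / 2 := by
      intro Qn rs' hS pre post g' hsplit hpow hsgn
      have heq : Q + rs.sum + (g :: pre).sum = Qn + rs'.sum + pre.sum := by
        rw [List.sum_cons, hS]; ring
      have := hsh (g :: pre) post g' (by rw [hsplit]; rfl) hpow (by rw [heq]; exact hsgn)
      rwa [heq] at this
    by_cases hq : (fastTwoSum fl g Q).2 = 0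
    · -- exact step: the carry becomes `g + Q`, nothing is emitted
      obtain ⟨inv', hQnval, hQn_ge⟩ := inv.absorb hp hfl hg hgbig hQg' hq
      rw [compressUp_cons_of_eq_zero hq] at hL
      generalize hQn : (fastTwoSum fl g Q).1 = Qn at *
      have hS : Qn + rs.sum = Q + rs.sum + g := by rw [hQnval]; ring
      have hQg_next : ∀ y ∈ rest.head?, |Qn| ≤ ulp p emin y := by
        intro y hy
        have hgy : |g| ≤ ulp p emin y := hgU y hy
        have hT : |Qn + rs.sum| < ulp p emin y := by rw [hS]; exact hst'.head_lt hy
        obtain ⟨u, -, hU⟩ := exists_ulp_eq_two_zpow (p := p) (emin := emin) y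
        obtain ⟨k, -, hK⟩ := exists_ulp_eq_two_zpow (p := p) (emin := emin) Q
        have hkQ : OnGrid k Q := by
          obtain ⟨K, hK'⟩ := exists_eq_int_mul_ulp_of_isFloat (p := p) (emin := emin) inv.hQ
          exact ⟨K, by rw [← hK]; exact hK'⟩
        have hkg : OnGrid k g := onGrid_of_two_zpow_le_ulp hg (by rw [← hK]; exact ulp_mono hQleg)
        have hkQn : OnGrid k Qn := by rw [hQnval]; exact hkg.add hkQ
        have hku : k ≤ u := by
          have : (2 : ℚ) ^ k ≤ (2 : ℚ) ^ u := by
            rw [← hK, ← hU]; exact (ulp_mono hQleg).trans (hulpg.trans hgy)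
          exact (zpow_le_zpow_iff_right₀ (by norm_num : (1 : ℚ) < 2)).mp this
        have hr : |rs.sum| < (2 : ℚ) ^ k := by rw [← hK]; exact inv.sum_lt
        rw [hU]
        exact abs_le_two_zpow_of_onGrid hku hkQn hr (by rw [← hU]; exact hT)
      have hI' : |rs.sum| ≤ ulp p emin Qn / 2 *
          (Finset.range rs.length).sum (fun i => ((2 : ℚ) ^ p)⁻¹ ^ i) :=
        hI.trans (mul_le_mul_of_nonneg_right
          (by linarith [ulp_mono (p := p) (emin := emin) hQn_ge]) (geomFactor_nonneg _))
      have hIs' : ∀ a : ℤ, |Qn| = 2 ^ a → Qn * rs.sum < 0 →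
          |rs.sum| ≤ ulp p emin Qn / 4 *
            (Finset.range rs.length).sum (fun i => ((2 : ℚ) ^ p)⁻¹ ^ i) := by
        intro a hQna _
        rw [hQnval] at hQna ⊢
        exact sum_le_quarter_ulp_after_absorb hp inv hgbig hQg' hQna hI hsh_g
      exact ih Qn rs inv' hI' hIs' hF' hbig' (by rw [hS]; exact hst') (hthread Qn rs hS) hch'
        hQg_next L t hL
    · -- emitting step: `q ≠ 0` is pushed on top of `rs`, the carry becomes `Qn = fl (g + Q)`
      obtain ⟨inv', hbound⟩ := inv.emit hp hfl le_rfl hflc hg hgbig hQg' hq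
      rw [compressUp_cons_of_ne_zero hq] at hL
      generalize hQn : (fastTwoSum fl g Q).1 = Qn at *
      generalize hqn : (fastTwoSum fl g Q).2 = q at *
      have hS : Qn + (q :: rs).sum = Q + rs.sum + g := by rw [List.sum_cons]; linarith [h4]
      have hQg_next : ∀ y ∈ rest.head?, |Qn| ≤ ulp p emin y := by
        intro y hy
        have hgy : |g| ≤ ulp p emin y := hgU y hy
        have hT : |Qn + (q :: rs).sum| < ulp p emin y := by rw [hS]; exact hst'.head_lt hy
        obtain ⟨u, hu, hU⟩ := exists_ulp_eq_two_zpow (p := p) (emin := emin) y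
        obtain ⟨k, -, hK⟩ := exists_ulp_eq_two_zpow (p := p) (emin := emin) (g + Q)
        have hkQn : OnGrid k Qn := by
          obtain ⟨K, hK'⟩ := exists_fl_eq_int_mul_ulp hp1 hfl (g + Q)
          exact ⟨K, by rw [h1, hK', hK]⟩
        have hku : k ≤ u := by
          have ht2 : |g + Q| ≤ 2 * (2 : ℚ) ^ u :=
            calc |g + Q| ≤ |g| + |Q| := abs_add_le _ _
              _ ≤ |g| + |g| := by linarith
              _ ≤ 2 * (2 : ℚ) ^ u := by rw [← hU]; linarith
          have := ulp_le_two_zpow_of_abs_le hp hu ht2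
          rw [hK] at this
          exact (zpow_le_zpow_iff_right₀ (by norm_num : (1 : ℚ) < 2)).mp this
        have hr : |(q :: rs).sum| < (2 : ℚ) ^ k := by rw [← hK, List.sum_cons]; exact hbound
        rw [hU]
        exact abs_le_two_zpow_of_onGrid hku hkQn hr (by rw [← hU]; exact hT)
      -- the old carry lies below the ulp of the new one …
      have hcarry : |Q| < ulp p emin Qn := by
        rw [h1]
        exact compressUp_carry_lt_ulp hp hfl inv hg hgbig hQg' (by rw [← h2']; exact hq) hsh_g
      -- … so what was emitted before shrinks by the factor `ε = 2^-p` relative to the new carry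
      have hrs : |rs.sum| ≤ ((2 : ℚ) ^ p)⁻¹ * ulp p emin Qn / 2 *
          (Finset.range rs.length).sum (fun i => ((2 : ℚ) ^ p)⁻¹ ^ i) := by
        cases rs with
        | nil => simp
        | cons r tail =>
          obtain ⟨u, hu, hU⟩ := exists_ulp_eq_two_zpow (p := p) (emin := emin) Qn
          obtain ⟨hup, hulpQ⟩ := ulp_le_two_zpow_of_upInv_cons inv (by rw [← hU]; exact hcarry)
          have hfac : (2 : ℚ) ^ (u - (p : ℤ)) = ((2 : ℚ) ^ p)⁻¹ * ulp p emin Qn := by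
            rw [hU, zpow_sub₀ (by norm_num : (2 : ℚ) ≠ 0), zpow_natCast, div_eq_inv_mul]
          rw [hfac] at hulpQ
          exact hI.trans (mul_le_mul_of_nonneg_right (by linarith) (geomFactor_nonneg _))
      have hq_half : |q| ≤ ulp p emin Qn / 2 := by
        rw [h2', h1]; exact abs_sub_fl_le_half_ulp_fl hp1 hfl (g + Q)
      have hI' : |(q :: rs).sum| ≤ ulp p emin Qn / 2 *
          (Finset.range (q :: rs).length).sum (fun i => ((2 : ℚ) ^ p)⁻¹ ^ i) := by
        rw [List.length_cons, geomFactor_succ, List.sum_cons]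
        calc |q + rs.sum| ≤ |q| + |rs.sum| := abs_add_le _ _
          _ ≤ ulp p emin Qn / 2 + ((2 : ℚ) ^ p)⁻¹ * ulp p emin Qn / 2 *
              (Finset.range rs.length).sum (fun i => ((2 : ℚ) ^ p)⁻¹ ^ i) :=
            add_le_add hq_half hrs
          _ = _ := by ring
      -- THE NEW PART: emitting onto a power of two from inside
      have hIs' : ∀ a : ℤ, |Qn| = 2 ^ a → Qn * (q :: rs).sum < 0 →
          |(q :: rs).sum| ≤ ulp p emin Qn / 4 *
            (Finset.range (q :: rs).length).sum (fun i => ((2 : ℚ) ^ p)⁻¹ ^ i) := by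
        intro a hQna hneg
        rw [List.sum_cons] at hneg
        have htail : |rs.sum| < |q| := abs_sum_tail_lt_head inv'.floats inv'.pw inv'.ne
        have hqQn : q * Qn < 0 :=
          mul_neg_of_abs_lt_of_add_mul_neg htail (by rw [mul_comm]; exact hneg)
        have hq0 : q ≠ 0 := inv'.ne q (by simp)
        have hQnF : IsFloat p emin Qn := by rw [h1]; exact (hfl _).1
        have hQn0 : Qn ≠ 0 := by
          intro h; rw [h, mul_zero] at hqQn; exact lt_irrefl _ hqQn
        -- `a ≥ emin + p`: otherwise `ulp Qn = 2^emin` and `|q| ≤ 2^emin/2` contradicts `q ≠ 0`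
        have ha : emin + p ≤ a := by
          by_contra hlt
          rw [not_le] at hlt
          have hulpe : ulp p emin Qn = 2 ^ emin := by
            rcases (show a < emin + p - 1 ∨ a = emin + p - 1 by omega) with h | h
            · exact ulp_eq_of_abs_lt (by rw [hQna]; exact zpow_lt_zpow_right₀ (by norm_num) h)
            · rw [← ulp_abs, hQna, ulp_two_zpow (by omega), h]; congr 1; ring
          have hqe : (2 : ℚ) ^ emin ≤ |q| :=
            (OnGrid.of_isFloat (inv'.floats q (by simp))).two_zpow_le_abs hq0
          rw [hulpe] at hq_half
          linarith [zpow_pos (by norm_num : (0 : ℚ) < 2) emin]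
        have hulpQn : ulp p emin Qn = 2 ^ (a - p + 1) := by
          rw [← ulp_abs, hQna, ulp_two_zpow (by omega)]
        -- `g + Q = Qn + q` lies strictly inside the power of two `Qn`: quarter roundoff
        have hin : |g + Q| < |Qn| := by
          have hqle : |q| ≤ |Qn| :=
            hq_half.trans (by linarith [ulp_le_abs_of_isFloat hQnF hQn0, abs_nonneg Qn])
          rw [← h4, abs_add_eq_sub_abs_of_mul_neg hqQn hqle]
          linarith [abs_pos.mpr hq0]
        have hq4 : |q| ≤ ulp p emin Qn / 4 := by
          have := abs_sub_fl_le_quarter_ulp_of_pow2 hp1 hfl (g + Q) ha (by rw [← h1]; exact hQna)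
            (by rw [← h1]; exact hin)
          rwa [← h2', ← h1] at this
        cases rs with
        | nil =>
          simp only [List.sum_cons, List.sum_nil, add_zero, List.length_singleton,
            Finset.sum_range_one, pow_zero, mul_one]
          exact hq4
        | cons r tl =>
          -- the carry before this step was below HALF an ulp of the power of two `Qn` …
          have hQsmall : |Q| < (2 : ℚ) ^ (a - p) :=
            carry_lt_half_ulp_of_pow2 hp hfl hg hQg' ha (by rw [← h1]; exact hQna)
              (by rw [hQna] at hin; exact hin)
              (by intro h; apply hq0; rw [h2', h, sub_self])
              (by rw [← h1]; exact hcarry)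
          -- … so `ulp Q ≤ 2^(a-2p)` and the older components weigh `≤ ε · ulp(Qn)/4 · G`
          obtain ⟨-, hulpQ⟩ := ulp_le_two_zpow_of_upInv_cons inv hQsmall
          have hfac : (2 : ℚ) ^ (a - p - (p : ℤ)) / 2 = ((2 : ℚ) ^ p)⁻¹ * (ulp p emin Qn / 4) := by
            rw [hulpQn, show a - p - (p : ℤ) = (a - p + 1) - 1 - p by ring, zpow_sub₀ h2,
              zpow_natCast, zpow_sub_one₀ h2]
            ring
          rw [List.length_cons, geomFactor_succ, List.sum_cons]
          calc |q + (r :: tl).sum| ≤ |q| + |(r :: tl).sum| := abs_add_le _ _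
            _ ≤ ulp p emin Qn / 4 + (2 : ℚ) ^ (a - p - (p : ℤ)) / 2 *
                (Finset.range (r :: tl).length).sum (fun i => ((2 : ℚ) ^ p)⁻¹ ^ i) :=
              add_le_add hq4
                (hI.trans (mul_le_mul_of_nonneg_right (by linarith) (geomFactor_nonneg _)))
            _ = _ := by rw [hfac]; ring
      have hlist : rs.reverse ++ q :: compressUp fl Qn rest =
          (q :: rs).reverse ++ compressUp fl Qn rest := by simp
      rw [hlist] at hL
      exact ih Qn (q :: rs) inv' hI' hIs' hF' hbig' (by rw [hS]; exact hst')
        (hthread Qn (q :: rs) hS) hch' hQg_next L t hL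

/-! ### The theorems -/

/-- **THE TOP ERROR OF COMPRESS AT A POWER OF TWO** (`p ≥ 2`, ANY round-to-nearest, every
nonoverlapping expansion `e` of floats).  If `compress fl e` read from the top is `L, t…` with
`|L| = 2^a` a power of two and the lower components pointing from `L` towards zero
(`L · Σ t < 0`), then `|Σ t| ≤ ulp(L)/4 · (1 + ε + ⋯ + ε^(k-1))` (`k = |t|`, `ε = 2^-p`) —
HALF the general bound `compress_top_error`.  Equivalently: the error of the top component is
at most `ulp(Σ e)/2 · (1 + ε + ⋯)` measured in ulps of the EXACT SUM, which drop by a factor two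
exactly in this configuration. -/
theorem compress_top_error_pow2 (hp : 2 ≤ p) (hfl : IsRoundNearest p emin fl) {e : List ℚ}
    (he : ∀ x ∈ e, IsFloat p emin x) (hexp : IsExpansion 1 e) :
    ∀ L t, (compress fl e).reverse = L :: t → ∀ a : ℤ, |L| = 2 ^ a → L * t.sum < 0 →
      |t.sum| ≤ ulp p emin L / 4 * (Finset.range t.length).sum (fun i => ((2 : ℚ) ^ p)⁻¹ ^ i) := by
  cases hrev : e.reverse with
  | nil =>
    have he0 : e = [] := by simpa using congrArg List.reverse hrev
    subst he0; simp [compress]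
  | cons em rest =>
    have he' : e = rest.reverse ++ [em] := by simpa using congrArg List.reverse hrev
    have hcomp : compress fl e =
        compressUp fl (compressDown fl em rest).2 (compressDown fl em rest).1.reverse := by
      simp only [compress, hrev]
    rw [hcomp]
    subst he'
    have hem : IsFloat p emin em := he em (by simp)
    have hrestF : ∀ y ∈ rest, IsFloat p emin y := fun y hy => he y (by simp [hy])
    have hexp' : IsExpansion 1 rest.reverse := hexp.sublist (List.sublist_append_left _ _)
    have hbel : ∀ y ∈ rest, Below 1 y em := fun y hy =>
      (List.pairwise_append.mp hexp).2.2 y (List.mem_reverse.mpr hy) em (by simp)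
    have outd := compressDown_spec hp hfl rest em hem hrestF hexp' hbel
    have hsharpD := compressDown_sharp_stair hp hfl rest em hem hrestF hexp' hbel
    generalize (compressDown fl em rest).1 = gs at *
    generalize (compressDown fl em rest).2 = gb at *
    have inv : UpInv p emin 1 [] gb :=
      ⟨by simp, outd.hgb, List.Pairwise.nil, by simp, by simp, by simpa using ulp_pos _⟩
    have hst : UStair p emin (gb + ([] : List ℚ).sum) gs.reverse := by
      have h := uStair_reverse_of_dStair outd.stair
      rw [List.reverse_append, List.reverse_singleton, List.singleton_append, uStair_cons,
        zero_add] at h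
      simpa using h.2
    have hch0 := List.isChain_reverse.mpr outd.chain
    rw [List.reverse_append, List.reverse_singleton, List.singleton_append,
      List.isChain_cons] at hch0
    -- the sharp stair, re-addressed from the bottom as the second traversal sees it
    have hsharpU : ∀ (pre post : List ℚ) (g : ℚ), gs.reverse = pre ++ g :: post →
        (∃ j : ℤ, emin + p ≤ j ∧ |g| = 2 ^ j) → g * (gb + ([] : List ℚ).sum + pre.sum) < 0 →
        |gb + ([] : List ℚ).sum + pre.sum| < ulp p emin g / 2 := by
      intro pre post g hsplit hpow hsgn
      have hgs : gs = post.reverse ++ g :: pre.reverse := by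
        simpa using congrArg List.reverse hsplit
      have hsum : (pre.reverse ++ [gb]).sum = gb + ([] : List ℚ).sum + pre.sum := by
        simp [List.sum_reverse, add_comm]
      have h := hsharpD post.reverse (pre.reverse ++ [gb]) g (by rw [hgs]; simp) hpow
        (by rw [hsum]; exact hsgn)
      rwa [hsum] at h
    intro L t hL
    exact compressUp_top_sharp hp hfl gs.reverse gb [] inv (by simp) (by intro a _ _; simp)
      (fun g hg => outd.floats g (List.mem_reverse.mp hg))
      (fun g hg => outd.big g (List.mem_reverse.mp hg)) hst hsharpU hch0.2 hch0.1 L t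
      (by simpa using hL)

end Summit.Ventures.CertifiedArithmetic.Expansions
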